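import Literature.AlgebraicGeometry.AbelianVarieties.MarkmanQuotientSquare
import Literature.AlgebraicGeometry.AbelianVarieties.MarkmanKernelTranslate
import Literature.AlgebraicGeometry.AbelianVarieties.FourierMukaiTransformPlus
import Literature.AlgebraicGeometry.AbelianVarieties.FourierMukaiExchangeTranslation
import Literature.AlgebraicGeometry.Modules.DerivedFlatBaseChange
import Literature.AlgebraicGeometry.Modules.PullbackTensorOfLocallyFree
import Literature.AlgebraicGeometry.Modules.TensorAssociator
import Literature.AlgebraicGeometry.Modules.TensorBraiding
import Literature.AlgebraicGeometry.Modules.TensorSheafHomIso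
import Literature.AlgebraicGeometry.Modules.SheafHomCoh
import Literature.AlgebraicGeometry.Morphisms.CohOfVectorBundle
import Literature.AlgebraicGeometry.Motives.AbelianVarietyDegree
import Literature.AlgebraicGeometry.Modules.DetClassOfIso
import HarnessLib

/-!
# The descended transform `E := R(pr_Y)_*(ε^*𝒩₀ ⊗ (ε ≫ pr₁₂)^*F₀)` on Markman's secant quotient `Y` and
# `q^*E ≅ Φ̃(F) ⊗ D′_s` (Markman 2025, §9.3 Remark 9.3.7, via Hartshorne III 9.3)

Layer `Literature/AlgebraicGeometry/AbelianVarieties`; sequel to `MarkmanQuotientSquare` ((K2): the cartesian square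
`(g′, π″; q, pr_Y)` and the kernel descent `π″^*(ε^*𝒩₀) ≅ 𝒩 ⊗ g′^*D′_s`), `MarkmanKernelTranslate` (the twisted kernel `𝒩`;
`Φ̃ := Φ^{pr₁₂, g′}_𝒩 = integralTransformPlus pr₁₂ g′ 𝒩` is `MarkmanPhiTilde.markmanPhiTildePlus`, not imported here) and
`Modules/DerivedFlatBaseChange` (flat base change on `D⁺` for one quasi-coherent sheaf). For Markman's secant data
(`A`, `Θ` ample with `K(Θ) = 0`, `n ≠ 0`, `G₁, G₂ ≤ A[n]`) and a quasi-coherent `𝒪`-module `F₀` on `A/G₁ × A/G₂`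
(so that `F := (π₁ × π₂)^*F₀` is the general `T = G₁ × G₂`-descended quasi-coherent sheaf on `A × A`):

* §0 instance facts as theorems (`haveI` at use): `AbelianVariety.isSeparated_left`, `flat_toSchemeHom_of_isIsogeny`,
  and the quasi-coherence of `L ⊗ M` for `L` finite locally free, `M` quasi-coherent (`isQuasicoherent_tensorObj_of_isFiniteLocallyFree`,
  through `L ⊗ M ≅ 𝓗om(L^∨, M)` and `Modules/SheafHomCoh`);
* §1 **(K3)** `markmanDescendedInput hj s m₁ m₂ F₀ := ε^*𝒩₀ ⊗ (ε ≫ pr₁₂)^*F₀` on `Y × A` (`ε = descentFactor hj`,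
  `𝒩₀ = markmanDescendedKernel s m₁ m₂`) and **`markmanDescendedTransform … F₀ := R(pr_Y)_*((markmanDescendedInput … F₀)[0])`**,
  an object of `D⁺(Mod 𝒪_Y)`;
* §2 **(K5)** `nonempty_pullback_markmanDescendedTransform_iso`:
  **`D⁺(q^*) E ≅ D⁺(D′_s ⊗ –) (Φ̃ (F[0]))`** for `F = (π₁ × π₂)^*F₀`, under the exponent hypotheses of
  `MarkmanKernelDescentIdentity` (`2j+1 = n`, `n m₁ = 2s+j+1`, `n m₂ + j = 2s`, `|Gᵢ| = n`) — the composition of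
  (i) flat base change `D⁺(q^*) R(pr_Y)_* Ñ₀[0] ≅ Rg′_* D⁺(π″^*) Ñ₀[0]` at the cartesian square of `MarkmanUntwist`
  (`q` a flat isogeny, `Y × A` compact separated, `Y` separated), (ii) `D⁺(π″^*)(Ñ₀[0]) ≅ (π″^*Ñ₀)[0]`,
  (iii) the module isomorphism `π″^*Ñ₀ ≅ g′^*D′_s ⊗ (𝒩 ⊗ pr₁₂^*F)` ((K2) + `π″ ≫ ε ≫ pr₁₂ = pr₁₂ ≫ (π₁ × π₂)`),
  (iv) the derived projection formula for the line bundle `D′_s` along `g′`, (v) `Φ̃ = Rg′_* ∘ D⁺(𝒩 ⊗ pr₁₂^*(–))`.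

Everything PROVED; 0 named facts; no instances; objectwise `Nonempty` statements. Cyclicity of `Gᵢ` and `G₁ ∩ G₂ = 0`
are not used. Typed for the cell `pub-hodge-ring2` ((K3)+(K5) of the kernel-descent road to crux 26512); a research
route conditional on HC_CM, not a corollary — nothing in this file refers to it.

## References

* E. Markman, arXiv:2502.03415 (2025), §9.3 Lemma 9.3.5, Remark 9.3.7 (pp. 71–73). [Markman2025SecantWeil]
* R. Hartshorne, *Algebraic Geometry*, GTM 52 (1977), III Prop. 9.3, II Ex. 5.1 (d), III Ex. 8.3. [Hartshorne1977]
* S. Mukai, Nagoya Math. J. 81 (1981), §1 (1.1), (1.4), §3 (3.1). [Mukai1981]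
* D. Mumford, *Abelian Varieties* (1970), §7 Thm. 4 (p. 72). [MumfordAV1970]
-/

noncomputable section

-- `TopCat.Presheaf`/`Scheme.Modules` are not reducible (as in Mathlib's `AlgebraicGeometry/Modules/Sheaf.lean`).
set_option backward.isDefEq.respectTransparency false

open CategoryTheory CategoryTheory.Limits AlgebraicGeometry MonoidalCategory CartesianMonoidalCategory
open AlgebraicGeometry.Scheme.Modules

universe v₁ v₂ v₃ v₄ v₅

namespace Literature.AlgebraicGeometry.AbelianVarieties

open Literature.AlgebraicGeometry.Motives Literature.AlgebraicGeometry.Modules Literature.AlgebraicGeometry.Markman2025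
open Literature.AlgebraicGeometry.Morphisms (coh_of_isVectorBundle)

/-! ### §0 Instance facts as theorems -/

section Instances

/-- **The underlying scheme of a complex abelian variety is separated** (it is proper over `Spec ℂ`).
[cite: MumfordAV1970, §4 (definition: complete, hence separated)] -/
theorem AbelianVariety.isSeparated_left (B : AbelianVariety ℂ) : B.X.left.IsSeparated := by
  constructor
  rw [← terminal.comp_from B.X.hom]
  infer_instance

/-- **An isogeny is flat** on underlying schemes (`IsIsogeny.flat_toSchemeHom_holds`, restated for `haveI`).
[cite: MumfordAV1970, §7 Thm. 4 (p. 72)] -/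
theorem flat_toSchemeHom_of_isIsogeny {B C : AbelianVariety ℂ} {f : B ⟶ C} (hf : AbelianVariety.IsIsogeny f) :
    Flat (AbelianVariety.Hom.toSchemeHom f) :=
  AbelianVariety.IsIsogeny.flat_toSchemeHom_holds hf

/-- **`L ⊗ M` is quasi-coherent for `L` finite locally free and `M` quasi-coherent** on a locally noetherian scheme
(`L ⊗ M ≅ 𝓗om(L^∨, M)`, and `𝓗om` of a coherent source into a quasi-coherent target is quasi-coherent).
[cite: Hartshorne1977, II Ex. 5.1 (b) and Prop. 5.7] -/
theorem isAffineLocalizing_tensorObj_of_isFiniteLocallyFree {X : Scheme.{0}} [IsLocallyNoetherian X] {L M : X.Modules}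
    (hL : IsFiniteLocallyFree L) (hM : IsAffineLocalizing M) : IsAffineLocalizing (tensorObj L M) := by
  have hLd := coh_of_isVectorBundle (isFiniteLocallyFree_dual hL).isVectorBundle
  exact IsAffineLocalizing.of_iso (tensorSheafHomDualIso L M hL).symm
    (isAffineLocalizing_sheafHom hLd.loc hLd.ft hM)

end Instances

/-! ### §1 (K3) The descended input and the descended transform -/

section Descent

variable (A : AbelianVariety ℂ) {Θ : CartierDivisor A.X.left} (hΘ : Θ.IsAmple) (hK : A.KTheta Θ = ⊥)
  {n : ℕ} (hn : n ≠ 0) (G₁ G₂ : Subgroup (A.Points ℂ)) (hG₁ : G₁ ≤ A.torsionPoints ℂ n) (hG₂ : G₂ ≤ A.torsionPoints ℂ n)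

/-- **`π₁ × π₂ : A × A → A/G₁ × A/G₂`** on underlying schemes. [cite: MumfordAV1970, §7 Thm. 4 (p. 72)] -/
abbrev quotientPairMap : (A.X ⊗ A.X).left ⟶ ((A.torsionQuot hn G₁ hG₁).X ⊗ (A.torsionQuot hn G₂ hG₂).X).left :=
  AbelianVariety.Hom.toSchemeHom (AbelianVariety.prodMap (A.torsionQuotHom hn G₁ hG₁) (A.torsionQuotHom hn G₂ hG₂))

/-- **`q : A × Â → Y`**, the secant quotient isogeny, on underlying schemes (typed on `A.X ⊗ Â.X`).
[cite: Markman2025SecantWeil, §1.5 (p. 7)] -/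
abbrev secantQuotientSchemeMap : (A.X ⊗ (A.dualOf Θ hΘ).X).left ⟶ (secantQuotient A hΘ G₁ G₂ hn hG₁ hG₂).X.left :=
  AbelianVariety.Hom.toSchemeHom (secantQuotientMap A hΘ G₁ G₂ hn hG₁ hG₂)

/-- **`pr_Y : Y × A → Y`** on underlying schemes (typed on `Y.X ⊗ A.X`). [cite: MumfordAV1970, §19] -/
abbrev secantQuotientFst : ((secantQuotient A hΘ G₁ G₂ hn hG₁ hG₂).X ⊗ A.X).left ⟶ (secantQuotient A hΘ G₁ G₂ hn hG₁ hG₂).X.left :=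
  AbelianVariety.Hom.toSchemeHom (AbelianVariety.fst (secantQuotient A hΘ G₁ G₂ hn hG₁ hG₂) A)

/-- **`π″ : (A × A) × Â → Y × A`** on underlying schemes (typed on `⊗`). [cite: Markman2025SecantWeil, §9.3 Remark 9.3.7 (p. 73)] -/
abbrev quotientProductSchemeMap (j : ℕ) :
    ((A.X ⊗ A.X) ⊗ (A.dualOf Θ hΘ).X).left ⟶ ((secantQuotient A hΘ G₁ G₂ hn hG₁ hG₂).X ⊗ A.X).left :=
  AbelianVariety.Hom.toSchemeHom (quotientProductHom A hΘ hK hn G₁ G₂ hG₁ hG₂ j)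

/-- **`ε : Y × A → (A/G₁ × A/G₂) × Â`** on underlying schemes (typed on `⊗`). [cite: Markman2025SecantWeil, §9.3 Remark 9.3.7 (p. 73)] -/
abbrev descentFactorSchemeMap {j : ℕ} (hj : 2 * j + 1 = n) :
    ((secantQuotient A hΘ G₁ G₂ hn hG₁ hG₂).X ⊗ A.X).left ⟶
      (((A.torsionQuot hn G₁ hG₁).X ⊗ (A.torsionQuot hn G₂ hG₂).X) ⊗ (A.dualOf Θ hΘ).X).left :=
  AbelianVariety.Hom.toSchemeHom (descentFactor A hΘ hK hn G₁ G₂ hG₁ hG₂ hj)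

/-- The cartesian square of `MarkmanUntwist`, `IsPullback g′ π″ q pr_Y`, read on the `⊗`-typed scheme maps.
[cite: Markman2025SecantWeil, §9.3 Remark 9.3.7 (p. 73)] -/
theorem isPullback_kernelSpanMap_quotientProductSchemeMap (j : ℕ) :
    IsPullback (kernelSpanMap A hΘ).left (quotientProductSchemeMap A hΘ hK hn G₁ G₂ hG₁ hG₂ j)
      (secantQuotientSchemeMap A hΘ hn G₁ G₂ hG₁ hG₂) (secantQuotientFst A hΘ hn G₁ G₂ hG₁ hG₂) :=
  isPullback_kernelSpanMap_quotientProduct A hΘ hK hn G₁ G₂ hG₁ hG₂ j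

/-- **(K3) The descended input `Ñ₀ := ε^*𝒩₀ ⊗ (ε ≫ pr₁₂)^*F₀` on `Y × A`.** [cite: Markman2025SecantWeil, §9.3 Remark 9.3.7 (p. 73)] -/
def markmanDescendedInput {j : ℕ} (hj : 2 * j + 1 = n) (s m₁ m₂ : ℕ)
    (F₀ : ((A.torsionQuot hn G₁ hG₁).X ⊗ (A.torsionQuot hn G₂ hG₂).X).left.Modules) :
    ((secantQuotient A hΘ G₁ G₂ hn hG₁ hG₂).X ⊗ A.X).left.Modules :=
  tensorObj
    ((Scheme.Modules.pullback (descentFactorSchemeMap A hΘ hK hn G₁ G₂ hG₁ hG₂ hj)).obj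
      (markmanDescendedKernel A hΘ hK hn G₁ G₂ hG₁ hG₂ s m₁ m₂))
    ((Scheme.Modules.pullback (descentFactorSchemeMap A hΘ hK hn G₁ G₂ hG₁ hG₂ hj ≫
      (pr₁₂ (A.torsionQuot hn G₁ hG₁) (A.torsionQuot hn G₂ hG₂) (A.dualOf Θ hΘ)).left)).obj F₀)

/-- `Ñ₀` is quasi-coherent (affine-localizing) for `F₀` quasi-coherent. [cite: Hartshorne1977, II Prop. 5.8 (a) and Ex. 5.1 (b)] -/
theorem isAffineLocalizing_markmanDescendedInput {j : ℕ} (hj : 2 * j + 1 = n) (s m₁ m₂ : ℕ)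
    (F₀ : ((A.torsionQuot hn G₁ hG₁).X ⊗ (A.torsionQuot hn G₂ hG₂).X).left.Modules) [F₀.IsQuasicoherent] :
    IsAffineLocalizing (markmanDescendedInput A hΘ hK hn G₁ G₂ hG₁ hG₂ hj s m₁ m₂ F₀) :=
  haveI : IsLocallyNoetherian ((secantQuotient A hΘ G₁ G₂ hn hG₁ hG₂).X ⊗ A.X).left :=
    inferInstanceAs (IsLocallyNoetherian ((secantQuotient A hΘ G₁ G₂ hn hG₁ hG₂).prod A).X.left)
  isAffineLocalizing_tensorObj_of_isFiniteLocallyFree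
    ((isFiniteLocallyFree_markmanDescendedKernel A hΘ hK hn G₁ G₂ hG₁ hG₂ s m₁ m₂).pullback _)
    ((IsAffineLocalizing.of_isQuasicoherent F₀).pullback _)

variable [HasDerivedCategory.{v₄} ((secantQuotient A hΘ G₁ G₂ hn hG₁ hG₂).X ⊗ A.X).left.Modules]
  [HasDerivedCategory.{v₅} (secantQuotient A hΘ G₁ G₂ hn hG₁ hG₂).X.left.Modules]

/-- **(K3) THE DESCENDED TRANSFORM `E := R(pr_Y)_*(Ñ₀[0]) ∈ D⁺(Mod 𝒪_Y)`**, `Ñ₀ = ε^*𝒩₀ ⊗ (ε ≫ pr₁₂)^*F₀`.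
[cite: Markman2025SecantWeil, §9.3 Remark 9.3.7 (p. 73)] -/
def markmanDescendedTransform {j : ℕ} (hj : 2 * j + 1 = n) (s m₁ m₂ : ℕ)
    (F₀ : ((A.torsionQuot hn G₁ hG₁).X ⊗ (A.torsionQuot hn G₂ hG₂).X).left.Modules) :
    DerivedCategory.Plus (secantQuotient A hΘ G₁ G₂ hn hG₁ hG₂).X.left.Modules :=
  (derivedPushforwardPlus (secantQuotientFst A hΘ hn G₁ G₂ hG₁ hG₂)).obj
    ((DerivedCategory.Plus.singleFunctor _ 0).obj (markmanDescendedInput A hΘ hK hn G₁ G₂ hG₁ hG₂ hj s m₁ m₂ F₀))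

end Descent

/-! ### §2 (K5) `q^*E ≅ Φ̃(F) ⊗ D′_s` -/

section Transform

variable (A : AbelianVariety ℂ) {Θ : CartierDivisor A.X.left} (hΘ : Θ.IsAmple) (hK : A.KTheta Θ = ⊥)
  {n : ℕ} (hn : n ≠ 0) (G₁ G₂ : Subgroup (A.Points ℂ)) (hG₁ : G₁ ≤ A.torsionPoints ℂ n) (hG₂ : G₂ ≤ A.torsionPoints ℂ n)

/-- **`π″ ≫ ε ≫ pr₁₂ = pr₁₂ ≫ (π₁ × π₂)`** on underlying schemes (`π″ ≫ ε = (π₁ × π₂) × 1_Â`).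
[cite: Markman2025SecantWeil, §9.3 Remark 9.3.7 (p. 73)] -/
theorem toSchemeHom_quotientProductHom_comp_descentFactor_comp_pr₁₂ {j : ℕ} (hj : 2 * j + 1 = n) :
    quotientProductSchemeMap A hΘ hK hn G₁ G₂ hG₁ hG₂ j ≫
        (descentFactorSchemeMap A hΘ hK hn G₁ G₂ hG₁ hG₂ hj ≫
          (pr₁₂ (A.torsionQuot hn G₁ hG₁) (A.torsionQuot hn G₂ hG₂) (A.dualOf Θ hΘ)).left) =
      (pr₁₂ A A (A.dualOf Θ hΘ)).left ≫ quotientPairMap A hn G₁ G₂ hG₁ hG₂ := by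
  have h : quotientProductHom A hΘ hK hn G₁ G₂ hG₁ hG₂ j ≫ descentFactor A hΘ hK hn G₁ G₂ hG₁ hG₂ hj ≫
      AbelianVariety.fst _ _ = AbelianVariety.fst _ _ ≫
        AbelianVariety.prodMap (A.torsionQuotHom hn G₁ hG₁) (A.torsionQuotHom hn G₂ hG₂) := by
    rw [← Category.assoc, quotientProductHom_comp_descentFactor, AbelianVariety.prodMap_fst]
  exact congrArg (fun φ => AbelianVariety.Hom.toSchemeHom φ) h

/-- **(iii) THE MODULE ISOMORPHISM `π″^*Ñ₀ ≅ g′^*D′_s ⊗ (𝒩 ⊗ pr₁₂^*F)`**, `F = (π₁ × π₂)^*F₀`: `π″^*` of the tensor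
product (`pullbackTensorIsoOfLeft`, `ε^*𝒩₀` locally free), the kernel descent of `MarkmanQuotientSquare` on the first
factor, `π″ ≫ ε ≫ pr₁₂ = pr₁₂ ≫ (π₁ × π₂)` on the second, and a reassociation.
[cite: Markman2025SecantWeil, §9.3 Lemma 9.3.5 and Remark 9.3.7 (pp. 71–73)] -/
def pullbackMarkmanDescendedInputIso {s j m₁ m₂ : ℕ} (hj : 2 * j + 1 = n) (hm₁ : n * m₁ = 2 * s + j + 1)
    (hm₂ : n * m₂ + j = 2 * s) (hc₁ : Nat.card G₁ = n) (hc₂ : Nat.card G₂ = n)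
    (F₀ : ((A.torsionQuot hn G₁ hG₁).X ⊗ (A.torsionQuot hn G₂ hG₂).X).left.Modules) :
    (Scheme.Modules.pullback (quotientProductSchemeMap A hΘ hK hn G₁ G₂ hG₁ hG₂ j)).obj
        (markmanDescendedInput A hΘ hK hn G₁ G₂ hG₁ hG₂ hj s m₁ m₂ F₀) ≅
      tensorObj ((Scheme.Modules.pullback (kernelSpanMap A hΘ).left).obj (descentTwist A hΘ hK s j))
        (tensorObj (markmanTwistedKernel A hΘ hK)
          ((Scheme.Modules.pullback (pr₁₂ A A (A.dualOf Θ hΘ)).left).obj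
            ((Scheme.Modules.pullback (quotientPairMap A hn G₁ G₂ hG₁ hG₂)).obj F₀))) :=
  let π'' := quotientProductSchemeMap A hΘ hK hn G₁ G₂ hG₁ hG₂ j
  let ε := descentFactorSchemeMap A hΘ hK hn G₁ G₂ hG₁ hG₂ hj
  let eK := (nonempty_pullback_quotientProduct_markmanKernel_iso A hΘ hK hn G₁ G₂ hG₁ hG₂ hj hm₁ hm₂ hc₁ hc₂).some
  let eF : (Scheme.Modules.pullback π'').obj ((Scheme.Modules.pullback (ε ≫
        (pr₁₂ (A.torsionQuot hn G₁ hG₁) (A.torsionQuot hn G₂ hG₂) (A.dualOf Θ hΘ)).left)).obj F₀) ≅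
      (Scheme.Modules.pullback (pr₁₂ A A (A.dualOf Θ hΘ)).left).obj
        ((Scheme.Modules.pullback (quotientPairMap A hn G₁ G₂ hG₁ hG₂)).obj F₀) :=
    (pullbackComp π'' _).app F₀ ≪≫
      (pullbackCongr (toSchemeHom_quotientProductHom_comp_descentFactor_comp_pr₁₂ A hΘ hK hn G₁ G₂ hG₁ hG₂ hj)).app F₀ ≪≫
      ((pullbackComp (pr₁₂ A A (A.dualOf Θ hΘ)).left (quotientPairMap A hn G₁ G₂ hG₁ hG₂)).app F₀).symm
  pullbackTensorIsoOfLeft π''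
      ((isFiniteLocallyFree_markmanDescendedKernel A hΘ hK hn G₁ G₂ hG₁ hG₂ s m₁ m₂).pullback ε) _ ≪≫
    ((tensorBifunctor _).mapIso eK).app _ ≪≫ ((tensorBifunctor _).obj _).mapIso eF ≪≫
    ((tensorBifunctor _).mapIso (tensorComm (markmanTwistedKernel A hΘ hK)
      ((Scheme.Modules.pullback (kernelSpanMap A hΘ).left).obj (descentTwist A hΘ hK s j)))).app _ ≪≫
    tensorAssoc _ _ _

variable [HasDerivedCategory.{v₁} (A.X ⊗ A.X).left.Modules]
  [HasDerivedCategory.{v₂} ((A.X ⊗ A.X) ⊗ (A.dualOf Θ hΘ).X).left.Modules]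
  [HasDerivedCategory.{v₃} (A.X ⊗ (A.dualOf Θ hΘ).X).left.Modules]
  [HasDerivedCategory.{v₄} ((secantQuotient A hΘ G₁ G₂ hn hG₁ hG₂).X ⊗ A.X).left.Modules]
  [HasDerivedCategory.{v₅} (secantQuotient A hΘ G₁ G₂ hn hG₁ hG₂).X.left.Modules]

/-- **(K5) `q^*E ≅ Φ̃(F) ⊗ D′_s` IN `D⁺(Mod 𝒪_{A×Â})`** for `E = R(pr_Y)_*(ε^*𝒩₀ ⊗ (ε ≫ pr₁₂)^*F₀)` and `F = (π₁ × π₂)^*F₀`,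
`F₀` quasi-coherent on `A/G₁ × A/G₂`: `D⁺(q^*) E ≅ D⁺(D′_s ⊗ –) (Φ̃ (F[0]))` (`q` the secant quotient isogeny, `Φ̃`
Markman's twisted transform written as the span transform `integralTransformPlus pr₁₂ g′ 𝒩` — this IS
`MarkmanPhiTilde.markmanPhiTildePlus A hΘ hK` by definition (`rfl`); `D′_s = descentTwist s j`). Hypotheses as in
`MarkmanKernelDescentIdentity`.
Proof: flat base change on `D⁺` (Hartshorne III 9.3, `Modules/DerivedFlatBaseChange`) at the cartesian square of
`MarkmanUntwist`, the module isomorphism `pullbackMarkmanDescendedInputIso`, the derived projection formula for `D′_s`.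
[cite: Markman2025SecantWeil, §9.3 Remark 9.3.7 (p. 73)] [cite: Hartshorne1977, III Prop. 9.3 and III Ex. 8.3] [cite: Mukai1981, §1 (1.4)] -/
theorem nonempty_pullback_markmanDescendedTransform_iso {s j m₁ m₂ : ℕ} (hj : 2 * j + 1 = n)
    (hm₁ : n * m₁ = 2 * s + j + 1) (hm₂ : n * m₂ + j = 2 * s) (hc₁ : Nat.card G₁ = n) (hc₂ : Nat.card G₂ = n)
    (F₀ : ((A.torsionQuot hn G₁ hG₁).X ⊗ (A.torsionQuot hn G₂ hG₂).X).left.Modules) [F₀.IsQuasicoherent] :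
    Nonempty
      ((haveI : Flat (secantQuotientSchemeMap A hΘ hn G₁ G₂ hG₁ hG₂) :=
          flat_toSchemeHom_of_isIsogeny (isIsogeny_secantQuotientMap A hΘ G₁ G₂ hn hG₁ hG₂)
        haveI := preservesFiniteLimits_pullback_of_flat (secantQuotientSchemeMap A hΘ hn G₁ G₂ hG₁ hG₂)
        (Scheme.Modules.pullback (secantQuotientSchemeMap A hΘ hn G₁ G₂ hG₁ hG₂)).mapDerivedCategoryPlus).obj
          (markmanDescendedTransform A hΘ hK hn G₁ G₂ hG₁ hG₂ hj s m₁ m₂ F₀) ≅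
        (haveI := additive_tensorBifunctor_obj (descentTwist A hΘ hK s j)
         haveI := (isInvertibleModule_of_hasRank_one (isFiniteLocallyFree_descentTwist A hΘ hK s j)
           (hasRank_descentTwist A hΘ hK s j)).preservesFiniteLimits
         haveI := (isInvertibleModule_of_hasRank_one (isFiniteLocallyFree_descentTwist A hΘ hK s j)
           (hasRank_descentTwist A hΘ hK s j)).preservesFiniteColimits
         ((tensorBifunctor (A.X ⊗ (A.dualOf Θ hΘ).X).left).obj (descentTwist A hΘ hK s j)).mapDerivedCategoryPlus).obj
          ((haveI := preservesFiniteLimits_pullback_pr₁₂ A A (A.dualOf Θ hΘ)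
            haveI := (isInvertibleModule_of_hasRank_one (isFiniteLocallyFree_markmanTwistedKernel A hΘ hK)
              (hasRank_markmanTwistedKernel A hΘ hK)).preservesFiniteLimits
            haveI := (isInvertibleModule_of_hasRank_one (isFiniteLocallyFree_markmanTwistedKernel A hΘ hK)
              (hasRank_markmanTwistedKernel A hΘ hK)).preservesFiniteColimits
            integralTransformPlus (pr₁₂ A A (A.dualOf Θ hΘ)).left (kernelSpanMap A hΘ).left (markmanTwistedKernel A hΘ hK)).obj
            ((DerivedCategory.Plus.singleFunctor _ 0).obj
              ((Scheme.Modules.pullback (quotientPairMap A hn G₁ G₂ hG₁ hG₂)).obj F₀)))) := by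
  -- notation
  let Y := secantQuotient A hΘ G₁ G₂ hn hG₁ hG₂
  let q := secantQuotientSchemeMap A hΘ hn G₁ G₂ hG₁ hG₂
  let π'' := quotientProductSchemeMap A hΘ hK hn G₁ G₂ hG₁ hG₂ j
  let g' := (kernelSpanMap A hΘ).left
  let p := (pr₁₂ A A (A.dualOf Θ hΘ)).left
  let N := markmanTwistedKernel A hΘ hK
  let D := descentTwist A hΘ hK s j
  let N₀ := markmanDescendedInput A hΘ hK hn G₁ G₂ hG₁ hG₂ hj s m₁ m₂ F₀
  let F := (Scheme.Modules.pullback (quotientPairMap A hn G₁ G₂ hG₁ hG₂)).obj F₀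
  -- instances (the `prod` forms of the schemes are the `⊗` forms by `rfl`, but instance search does not unfold)
  haveI : Flat q := flat_toSchemeHom_of_isIsogeny (isIsogeny_secantQuotientMap A hΘ G₁ G₂ hn hG₁ hG₂)
  haveI := preservesFiniteLimits_pullback_of_flat q
  have hsq := isPullback_kernelSpanMap_quotientProductSchemeMap A hΘ hK hn G₁ G₂ hG₁ hG₂ j
  haveI : Flat π'' := flat_snd_of_isPullback hsq
  haveI := preservesFiniteLimits_pullback_of_flat π''
  haveI : CompactSpace ↑((secantQuotient A hΘ G₁ G₂ hn hG₁ hG₂).X ⊗ A.X).left :=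
    AbelianVariety.compactSpace_left (Y.prod A)
  haveI : ((secantQuotient A hΘ G₁ G₂ hn hG₁ hG₂).X ⊗ A.X).left.IsSeparated := AbelianVariety.isSeparated_left (Y.prod A)
  haveI := AbelianVariety.isSeparated_left Y
  haveI : N₀.IsQuasicoherent :=
    isQuasicoherent_of_isAffineLocalizing (isAffineLocalizing_markmanDescendedInput A hΘ hK hn G₁ G₂ hG₁ hG₂ hj s m₁ m₂ F₀)
  have hD := isFiniteLocallyFree_descentTwist A hΘ hK s j
  have hD1 := hasRank_descentTwist A hΘ hK s j
  haveI := additive_tensorBifunctor_obj D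
  haveI := (isInvertibleModule_of_hasRank_one hD hD1).preservesFiniteLimits
  haveI := (isInvertibleModule_of_hasRank_one hD hD1).preservesFiniteColimits
  haveI := additive_tensorBifunctor_obj ((Scheme.Modules.pullback g').obj D)
  haveI := (isInvertibleModule_of_hasRank_one (hD.pullback g') (hasRank_pullback g' hD1)).preservesFiniteLimits
  haveI := (isInvertibleModule_of_hasRank_one (hD.pullback g') (hasRank_pullback g' hD1)).preservesFiniteColimits
  haveI := preservesFiniteLimits_pullback_pr₁₂ A A (A.dualOf Θ hΘ)
  haveI := (isInvertibleModule_of_hasRank_one (isFiniteLocallyFree_markmanTwistedKernel A hΘ hK)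
    (hasRank_markmanTwistedKernel A hΘ hK)).preservesFiniteLimits
  haveI := (isInvertibleModule_of_hasRank_one (isFiniteLocallyFree_markmanTwistedKernel A hΘ hK)
    (hasRank_markmanTwistedKernel A hΘ hK)).preservesFiniteColimits
  haveI := additive_integralKernelFunctor p N
  haveI := preservesFiniteLimits_integralKernelFunctor p N
  haveI := preservesFiniteColimits_integralKernelFunctor p N
  -- (i) flat base change at the cartesian square `(g′, π″; q, pr_Y)`
  obtain ⟨e₁⟩ := derivedPushforwardPlus_flatBaseChange_single_of_isSeparated hsq N₀
  -- (ii) `D⁺(π″^*)(Ñ₀[0]) ≅ (π″^*Ñ₀)[0]`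
  let e₂ := (derivedPushforwardPlus g').mapIso (mapDerivedCategoryPlusSingleIso (Scheme.Modules.pullback π'') N₀)
  -- (iii) the module isomorphism
  let e₃ := (derivedPushforwardPlus g').mapIso ((DerivedCategory.Plus.singleFunctor _ 0).mapIso
    (pullbackMarkmanDescendedInputIso A hΘ hK hn G₁ G₂ hG₁ hG₂ hj hm₁ hm₂ hc₁ hc₂ F₀))
  -- (iv) the derived projection formula for `D′_s` along `g′`
  let e₄ := (derivedPushforwardPlus g').mapIso
    (mapDerivedCategoryPlusSingleIso ((tensorBifunctor _).obj ((Scheme.Modules.pullback g').obj D))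
      ((integralKernelFunctor p N).obj F)).symm ≪≫
    (derivedProjectionFormulaIso g' hD hD1).app ((DerivedCategory.Plus.singleFunctor _ 0).obj ((integralKernelFunctor p N).obj F))
  -- (v) `Φ̃(F[0]) = Rg′_*(D⁺(𝒩 ⊗ pr₁₂^*(–))(F[0])) ≅ Rg′_*((𝒩 ⊗ pr₁₂^*F)[0])`
  let e₅ := (((tensorBifunctor _).obj D).mapDerivedCategoryPlus).mapIso
    ((derivedPushforwardPlus g').mapIso (mapDerivedCategoryPlusSingleIso (integralKernelFunctor p N) F).symm)
  exact ⟨e₁ ≪≫ e₂ ≪≫ e₃ ≪≫ e₄ ≪≫ e₅⟩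

end Transform


end Literature.AlgebraicGeometry.AbelianVarieties

end
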